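import Summits.HodgeConjecture.HodgeConjecture.Theses.NikulinTwinTransport

/-!
# `TwinTwistorTransport` (stmt-HodgeConjecture-14522) · Negative · the anchor cone condition is pinned

Tightness record for the hypothesis "`𝒦_X ∩ Ψ(𝒦_{Y′}) ≠ ∅`" (Markman 2024 §5.2: a quadruple carries
a Kähler class `ω₁ ∈ 𝒦_{X₁} ∩ ψ_q⁻¹(𝒦_{X₂})`) of the typed form of the informal crux
`TwinTwistorTransport` (route NikulinTwinTransport, r4) AT THE NIKULIN ANCHOR `(X, Y′)`.  At the
projective ENDPOINT a failure of the cone condition is repaired by composing the markings with Weyl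
reflections `s_C = [Δ + C × C]_*`, which are algebraic (Buskin 2019 Prop. 6.2).  At the ANCHOR it
cannot be repaired that way: the similitude is pinned by the carrier — `c₂^{mixed}(G) = m·graph(Ψ_G)`
is `SU(2)`-invariant only for hyperkähler structures whose Kähler classes are matched by the SAME
`Ψ_G` — and `Δ + C × C` is a correspondence, not an automorphism transporting the stable sheaf `G`.
So whether SOME Kähler `ω′` on `Y′` has `Ψ_G(ω′)` Kähler on `X` is a genuine condition on the Nikulin
family.  This file records the dichotomy for the direct-sum type `NS(X) = ⟨2d⟩ ⊕ E₈(−2)` of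
van Geemen–Sarti 2007 Prop. 2.2 (classes `a·h + e`, `h² = 2d`, `e ∈ E₈(−2)` so `e² ∈ 4ℤ`):

* `no_minusTwo_class_of_even_degree`: for `d` even, `2da² + e² ≠ −2` — NO `(−2)`-classes, hence
  `𝒦_X = 𝒞⁺_X` (Huybrechts, K3 book, Ch. 8: the Kähler cone is cut out of the positive cone by the
  `(−2)`-curves) and EVERY Kähler class of `Y′` is admissible (`(Ψω′)² = 2ω′² > 0`,
  `(Ψω′.h) = (ω′.q_*p^*h) > 0`): the cone condition is automatic — choose such a family;
* `minusTwo_class_of_degree_one`: for `d = 1` (and every odd `d`) `(−2)`-classes `h ± e` exist (`e` a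
  root of `E₈(−2)`, square `−4`; certified on Mathlib's `CartanMatrix.E₈`), and `Ψω′` Kähler then
  requires `(ω′.q_*p^*h) > ½|Σⱼ cⱼ (rⱼ.e)|` (`cⱼ = (ω′.Nⱼ)`), pushing `ω′` towards the nodal face
  `N^⊥` — the regime `Nⱼ.ω′ → 0` in which the route's cheapest falsifier tests the Serre carrier.

Refuter seat refuter-cdisprove-stmt-HodgeConjecture-14522-g2-0 (gen 2), 2026-08-15.
-/

namespace Summit.HodgeConjecture.HodgeConjecture.Theorems.TwinTwistorTransport.Negative

/-- Even degree: no `(−2)`-class `a·h + e` in `⟨2d⟩ ⊕ E₈(−2)` (`e² = e2 ∈ 4ℤ`). [folklore] -/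
theorem no_minusTwo_class_of_even_degree (d a e2 : ℤ) (hd : Even d) (he : 4 ∣ e2) :
    2 * d * a ^ 2 + e2 ≠ -2 := by
  obtain ⟨r, rfl⟩ := hd
  obtain ⟨k, rfl⟩ := he
  have : 2 * (r + r) * a ^ 2 + 4 * k = 4 * (r * a ^ 2 + k) := by ring
  rw [this]
  omega

/-- Degree one: a root `e` of `E₈(−2)` has square `−4` (first simple root of Mathlib's `E₈`), and
`h + e` is a `(−2)`-class: `2·1·1² − 4 = −2`. [folklore] -/
theorem minusTwo_class_of_degree_one :
    (-2 : ℤ) * CartanMatrix.E₈ 0 0 = -4 ∧ (2 : ℤ) * 1 * 1 ^ 2 + (-4) = -2 := by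
  refine ⟨?_, by norm_num⟩
  decide

end Summit.HodgeConjecture.HodgeConjecture.Theorems.TwinTwistorTransport.Negative
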